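import Mathlib
import HarnessLib
import Summits.NavierStokesRegularity.NavierStokesRegularity.Theses.RootDecompLeanestSingularity
import Summits.NavierStokesRegularity.NavierStokesRegularity.Theorems.RootDecompLeanestSingularityNoHollowSpike
import Summits.NavierStokesRegularity.NavierStokesRegularity.Theorems.RootDecompLeanestSingularityFrozenZoomIsLerayProfile
import Literature.Analysis.FluidPDE.WeakL3SteadyLiouville

/-!
# RootDecompLeanestSingularity — support F `NoFrozenSpike` (stmt-NavierStokesRegularity-32164) PROVED

Route N14 `route-NavierStokesRegularity-RootDecompLeanestSingularity` (decomp-ns lens-4 g11 SPIKE ANATOMY node,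
booked by writer g4 as E `LeanTypeIIEnveloped` / N `LeanEnvelopedIsTypeI` / F `NoFrozenSpike` 32164 /
K `NoHollowSpike` 32165 / S2 `FrozenZoomIsLerayProfile` 32163). The item's docstring: «THEOREM-GRADE, PROVED
modulo S2 (lens kernel `noFrozenSpike_of_stub`)»; S2 is now the tree theorem
`FrozenZoomIsLerayProfile.frozenZoomIsLerayProfile_proof` (writer g13), so F closes outright. This file is the
port of the lens kernel `noFrozenSpike_of` (§6 of HOME/decomp-ns-lens-4/SpikeAnatomy.lean) with the lens
vocabulary (`IsEnveloped`, `IsZoomLimit`, `InOseenClass`, `IsNontrivialFlow`, `IsFrozen`, `IsEnvelopedFlow`)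
written out exactly as in the born decl (no new definitions), concluded against the route decl BY NAME.

Content — «inside a weak-`L³` envelope a blow-up core cannot freeze». For every ENVELOPED Clay blow-up (maximal
smooth Leray–Hopf solution of finite lifespan from a rapidly decaying datum whose slices are uniformly bounded in
weak-`L³` on `[0,T)`; no leanness, no marginality, any time rate), no nontrivial zoom limit `U` in the bounded
Oseen ancient class is FROZEN (time independent). Proof: S1 (landed, `NoHollowSpike.isEnvelopedFlow_of_zoomLimit`:
Fatou for super-level sets + Haar scaling) puts every slice of `U` in weak-`L³`; S2 (landed) makes `U(−1)` a
`C²` steady Navier–Stokes flow with a `C¹` pressure; the weak-`L³` steady Liouville theorem (Seregin–Wang 2020 /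
Tsai 2021, tree PROVED `WeakL3SteadyLiouville.eq_zero_of_memWeakLp_three`) gives `U(−1) = 0`; frozenness
spreads this to every negative slice, contradicting nontriviality. Closes the «regular steady state» exit of the
Matano–Merle Type-II threshold mechanism for Navier–Stokes. Navier–Stokes regularity is NOT proved by anything
here (rung 0): the lineage's residual E `LeanTypeIIEnveloped` (32147) and N `LeanEnvelopedIsTypeI` (32146) stay
open; with K (g12) and F (this file) BOTH anatomy exits of N are closed.

References: Tsai2021 arXiv:1803.01051 Thm 1.1 (a); SereginWang2020; KochNadirashviliSereginSverak2009
arXiv:0709.3599 §4; AlbrittonBarker2019 arXiv:1811.00502; tree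
`Literature.Analysis.FluidPDE.WeakL3SteadyLiouville.eq_zero_of_memWeakLp_three`,
`Summit.NavierStokesRegularity.NavierStokesRegularity.Theorems.NoHollowSpike.isEnvelopedFlow_of_zoomLimit`,
`Summit.NavierStokesRegularity.NavierStokesRegularity.Theorems.FrozenZoomIsLerayProfile.frozenZoomIsLerayProfile_proof`.
-/
noncomputable section

-- the summit and its single sub-problem share the name (CONVENTIONS §1), as in every Theorems file

set_option linter.dupNamespace false

open MeasureTheory Set Function Filter Topology
open scoped NNReal ENNReal RealInnerProductSpace
open Literature.Analysis Literature.Analysis.FluidPDE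

namespace Summit.NavierStokesRegularity.NavierStokesRegularity.Theorems.NoFrozenSpike

/-- A continuous slice of an enveloped flow lies in weak-`L³` (`FunctionSpaces.MemWeakLp`): the envelope
`σ³ · vol{σ < |U(t)|} ≤ M < ∞` is exactly the finiteness of `sup_σ σ³ μ{|U(t)| > σ}`. (Lens
`memWeakLp_slice_of_isEnvelopedFlow`, with `IsEnvelopedFlow` written out.) -/
theorem memWeakLp_slice_of_isEnvelopedFlow
    {U : ℝ → EuclideanSpace ℝ (Fin 3) → EuclideanSpace ℝ (Fin 3)}
    (h : ∃ M : ℝ≥0∞, M < ⊤ ∧ ∀ t : ℝ, t < 0 → ∀ σ : ℝ, 0 < σ →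
      ENNReal.ofReal σ ^ 3 * volume {x : EuclideanSpace ℝ (Fin 3) | σ < ‖U t x‖} ≤ M)
    {t : ℝ} (ht : t < 0) (hc : Continuous (U t)) : FunctionSpaces.MemWeakLp (U t) 3 volume := by
  obtain ⟨M, hM, hMU⟩ := h
  refine ⟨hc.aestronglyMeasurable, lt_of_le_of_lt ?_ hM⟩
  refine iSup_le fun r => ?_
  rcases eq_or_ne r 0 with rfl | hr
  · simp
  · have hr' : 0 < (r : ℝ) := NNReal.coe_pos.2 (pos_iff_ne_zero.2 hr)
    have h3 : (3 : ℝ≥0∞).toReal = ((3 : ℕ) : ℝ) := by norm_num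
    have hset : {x : EuclideanSpace ℝ (Fin 3) | (r : ℝ≥0∞) < ‖U t x‖ₑ} =
        {x | (r : ℝ) < ‖U t x‖} := by
      ext x
      simp only [mem_setOf_eq]
      rw [← ofReal_norm, ENNReal.lt_ofReal_iff_toReal_lt ENNReal.coe_ne_top,
        ENNReal.coe_toReal]
    rw [h3, ENNReal.rpow_natCast, hset, ← ENNReal.ofReal_coe_nnreal]
    exact hMU t ht r hr'

/-- **F from S1 and S2** (kernel of the frozen exit, lens `noFrozenSpike_of`): a frozen zoom limit is, at time
`−1`, a `C²` steady Navier–Stokes flow (S2) whose velocity lies in weak-`L³` (S1); the weak-`L³` steady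
Liouville theorem makes it zero, contradicting nontriviality. -/
theorem noFrozenSpike_of
    (hS2 : Theses.RootDecompLeanestSingularity.FrozenZoomIsLerayProfile) :
    Theses.RootDecompLeanestSingularity.NoFrozenSpike := by
  intro ν T hν hT u p hmax hLH hdec henv U hzoom hcls hnt hfro
  have hflow := NoHollowSpike.isEnvelopedFlow_of_zoomLimit (u := u) (U := U) hν henv hzoom
  obtain ⟨P, hprof⟩ := hS2 U hcls hfro
  have hc : Continuous (U (-1)) :=
    hcls.1.comp_continuous (continuous_const.prodMk continuous_id) fun x =>
      ⟨show (-1 : ℝ) < 0 by norm_num, mem_univ x⟩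
  have hmem : FunctionSpaces.MemWeakLp (U (-1)) 3 volume :=
    memWeakLp_slice_of_isEnvelopedFlow hflow (by norm_num) hc
  have hW0 : U (-1) = 0 := WeakL3SteadyLiouville.eq_zero_of_memWeakLp_three one_pos hprof hmem
  obtain ⟨t, ht, x, hx⟩ := hnt
  exact hx (by rw [hfro t (-1) ht (by norm_num), hW0]; rfl)

/-- **Support F `NoFrozenSpike` (stmt-NavierStokesRegularity-32164) holds**, concluded BY NAME: S2 is the tree
theorem `FrozenZoomIsLerayProfile.frozenZoomIsLerayProfile_proof`. -/
theorem noFrozenSpike_proof : Theses.RootDecompLeanestSingularity.NoFrozenSpike :=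
  noFrozenSpike_of FrozenZoomIsLerayProfile.frozenZoomIsLerayProfile_proof

end Summit.NavierStokesRegularity.NavierStokesRegularity.Theorems.NoFrozenSpike
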